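import Mathlib.Algebra.CharP.Lemmas
import Mathlib.Tactic.LinearCombination
import Mathlib.Tactic.Ring

/-!
# SoloBlind — the key identities behind the multiplicative normal form (Theorem M)

Solo line `solo-ResolutionOfSingularities-blind`, session 4.  In characteristic `p`, consider on
`K[[x₁,…,xₙ]]` the automorphism `σ(xᵢ) = xᵢ · U^{aᵢ}` with `U = 1 + w`, `w = x^λ`, `⟨a,λ⟩ = -1`
("multiplicative normal form" of a wild `ℤ/p`-action).  Theorem M of the accompanying paper says that the
ring of invariants is the toric ring `K[[Γ_a]]`, `Γ_a = {m : ⟨a,m⟩ ≡ 0 (mod p)}`, topologically spanned by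
`E_m = x^m (1 - w^{p-1})^{⟨a,m⟩/p}`.  The two identities that carry the proof are kernel-checked here, in
an arbitrary commutative ring of characteristic `p` (no power series needed):

* `SoloBlind.normalForm_key` : `(1 + w) * ((1 + w)^(p-1) - w^(p-1)) = 1 - w^(p-1)`;
* `SoloBlind.normalForm_generator_invariant` : the invariance `σ(E_m) = E_m` for the surface family
  `σ(s) = s·U^a`, `σ(w) = w·U⁻¹`, written denominator-free (multiplied through by `U^(n + e(p-1))`):
  if `a*m = n + p*e` then `(s U^a)^m · w^n · (U^{p-1} - w^{p-1})^e = s^m · w^n · (1 - w^{p-1})^e · U^{n + e(p-1)}`.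

Dividing the second identity by the unit `U^{n+e(p-1)}` of `K[[s,w]]` gives
`σ(s)^m σ(w)^n (1 - σ(w)^{p-1})^e = s^m w^n (1 - w^{p-1})^e`, i.e. `σ(E_{(m,n)}) = E_{(m,n)}`.
-/

namespace Summit.ResolutionOfSingularities.ResolutionOfSingularities.Theorems


/-- The characteristic-`p` identity `(1+w)((1+w)^{p-1} - w^{p-1}) = 1 - w^{p-1}`, stated with
`p = q + 1` so that only the Frobenius identity `(1+w)^p = 1 + w^p` is used. -/
theorem SoloBlind.normalForm_key {R : Type*} [CommRing R] (p : ℕ) [hp : Fact p.Prime] [CharP R p]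
    (w : R) (q : ℕ) (hq : p = q + 1) :
    (1 + w) * ((1 + w) ^ q - w ^ q) = 1 - w ^ q := by
  have H : (1 + w) ^ p = 1 ^ p + w ^ p := add_pow_char 1 w p
  rw [one_pow, hq] at H
  linear_combination H

/-- Denominator-free form of the invariance `σ(E_m) = E_m` of the generators of the toric ring of
invariants (Theorem M, surface family `σ(s) = s(1+w)^a`, `σ(w) = w/(1+w)`): with `U = 1 + w` and
`a*m = n + p*e`,
`(s·U^a)^m · w^n · (U^{p-1} - w^{p-1})^e = s^m · w^n · (1 - w^{p-1})^e · U^{n + e·(p-1)}`. -/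
theorem SoloBlind.normalForm_generator_invariant {R : Type*} [CommRing R] (p : ℕ) [hp : Fact p.Prime]
    [CharP R p] (s w : R) (q : ℕ) (hq : p = q + 1) (a m n e : ℕ) (h : a * m = n + p * e) :
    (s * (1 + w) ^ a) ^ m * w ^ n * ((1 + w) ^ q - w ^ q) ^ e
      = s ^ m * w ^ n * (1 - w ^ q) ^ e * (1 + w) ^ (n + e * q) := by
  have key := SoloBlind.normalForm_key (R := R) p w q hq
  rw [← key]
  simp only [mul_pow]
  rw [← pow_mul, h, hq]
  ring

end Summit.ResolutionOfSingularities.ResolutionOfSingularities.Theorems
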